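import Literature.MathematicalPhysics.QuantumLattice.HeisenbergMarshallCorrelationSign
import Literature.MathematicalPhysics.QuantumLattice.HeisenbergRPCorrelationBlocks
import HarnessLib

/-!
# Marshall's sign rule for same-sublattice correlations

Topic `MathematicalPhysics/QuantumLattice` (family `hubbard`); sibling proof file (theorems only,
no definitions, no named facts) of `HeisenbergMarshallCorrelationSign.lean`, which proves the
OPPOSITE-sublattice half of Marshall's sign rule for ground-state correlations
(`groundStateSpinCorrTorus_nonpos_of_parity_ne`: `⟨𝐒_x·𝐒_y⟩₀ ≤ 0` for `x`, `y` of opposite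
parity). This file proves the SAME-sublattice half and packages both halves in the bookkeeping of
the reduced two-point function `c(a,b) = heisRedCorr2 L n a b` used by the finite-volume linear
programmes of the Hubbard-ladder cell.

For the spin-`n/2` Heisenberg antiferromagnet `H = J Σ_{edges} 𝐒_x·𝐒_y`, `J > 0`, on a finite
connected graph bipartite in `A`, `Aᶜ` with `|A| = |Aᶜ|`, the unique ground state `ψ` has
amplitudes `c (-1)^{Σ_{z∈A} σ_z} ψ(σ) ≥ 0` (Marshall 1955; Lieb–Mattis 1962, Thm 2). The spin-flip
part `½(S⁺_xS⁻_y + S⁻_xS⁺_y)` of `𝐒_x·𝐒_y` has nonnegative matrix elements between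
configurations differing by one hop `x ↔ y`; such a hop PRESERVES the Marshall sign when `x`, `y`
lie on the same side of `A` (and flips it when they lie on opposite sides). Hence

* `LiebMattis.marshallSign_mul_marshallSign_of_hop_same` — a hop inside a sublattice class
  preserves `(-1)^{Σ_A σ}`;
* `LiebMattis.re_dotProduct_spinZ_mulVec_le_spinDot_of_marshall` — **vector form**: for a
  Marshall-positive vector and `x ≠ y` on the same side of `A`,
  `Re⟨ψ, Sᶻ_xSᶻ_y ψ⟩ ≤ Re⟨ψ, 𝐒_x·𝐒_y ψ⟩`;
* `LiebMattis.re_groundStateFunctional_spinZ_le_spinDot` — the same in the unique ground state;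
* on the even torus `(ℤ/Lℤ)^d` (sublattices = parity classes), with isotropy
  `⟨𝐒_x·𝐒_y⟩₀ = 3⟨Sᶻ_xSᶻ_y⟩₀` (Kennedy–Lieb–Shastry 1988, p. 1021):
  `groundStateSpinCorrTorus_nonneg_of_parity_eq` — **`⟨𝐒_x·𝐒_y⟩₀ ≥ 0` whenever `x`, `y` have the
  same parity**; and for the reduced two-point function of the square torus, `L` even:
  `heisRedCorr2_nonneg_of_even` (`c(a,b) ≥ 0` for `a + b` even) and `heisRedCorr2_nonpos_of_odd`
  (`c(a,b) ≤ 0` for `a + b` odd) — Marshall's sign rule `sign c(r) = (-1)^{‖r‖₁}`.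

## References
* W. Marshall, Proc. Roy. Soc. A 232 (1955) 48–68 (the sign rule). [Marshall1955]
* E. Lieb, D. Mattis, J. Math. Phys. 3 (1962) 749–751, Theorem 2 and its proof (positivity of the
  rotated ground-state amplitudes on a balanced bipartite graph, general spin). [LiebMattis1962]
* T. Kennedy, E. H. Lieb, B. S. Shastry, J. Stat. Phys. 53 (1988) 1019–1030, p. 1021 (isotropy of
  the ground-state correlations). [KLS1988JSP]
* A. Auerbach, *Interacting Electrons and Quantum Magnetism* (1994), Thm 5.1, eqs. (5.12)–(5.13)
  (Marshall's theorem). [Auerbach1994]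
-/

noncomputable section

open Matrix Finset
open scoped ComplexOrder BigOperators ComplexConjugate

namespace Literature.MathematicalPhysics.QuantumLattice

/-! ### A hop inside a sublattice class preserves the Marshall sign -/

namespace LiebMattis

variable {Λ : Type*} [Fintype Λ] [DecidableEq Λ] {q : ℕ} (n : ℕ)

omit [Fintype Λ] in
/-- **A hop inside a sublattice class preserves the Marshall sign**: if `τ` is obtained from `σ`
by a hop between `x` and `y` with `x ∈ A ↔ y ∈ A`, then `(-1)^{Σ_A σ} (-1)^{Σ_A τ} = 1`
(the `A`-weight is unchanged). Marshall (1955); Lieb–Mattis (1962), proof of Thm 2.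
[cite: LiebMattis1962, Theorem 2] [cite: Marshall1955, sign rule] -/
theorem marshallSign_mul_marshallSign_of_hop_same (A : Finset Λ) {x y : Λ}
    (hA : x ∈ A ↔ y ∈ A) {σ τ : TensorIndex Λ q}
    (hx : (τ x).val = (σ x).val + 1) (hy : (σ y).val = (τ y).val + 1)
    (hrest : ∀ z, z ≠ x → z ≠ y → σ z = τ z) :
    marshallSign A σ * marshallSign A τ = 1 := by
  have hxy : x ≠ y := by
    rintro rfl
    omega
  have key : (∑ z ∈ A, (τ z : ℕ)) = ∑ z ∈ A, (σ z : ℕ) := by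
    by_cases hxA : x ∈ A
    · have hyA : y ∈ A := hA.1 hxA
      have hy' : y ∈ A.erase x := Finset.mem_erase.2 ⟨hxy.symm, hyA⟩
      rw [← Finset.add_sum_erase A _ hxA, ← Finset.add_sum_erase A _ hxA,
        ← Finset.add_sum_erase (A.erase x) _ hy', ← Finset.add_sum_erase (A.erase x) _ hy', hx]
      have : ∑ z ∈ (A.erase x).erase y, (τ z : ℕ) = ∑ z ∈ (A.erase x).erase y, (σ z : ℕ) :=
        Finset.sum_congr rfl fun z hz => by
          rw [hrest z (Finset.ne_of_mem_erase (Finset.mem_of_mem_erase hz))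
            (Finset.ne_of_mem_erase hz)]
      rw [this]
      omega
    · have hyA : y ∉ A := fun h => hxA (hA.2 h)
      exact Finset.sum_congr rfl fun z hz => by
        rw [hrest z (fun h => hxA (h ▸ hz)) (fun h => hyA (h ▸ hz))]
  rw [marshallSign, marshallSign, key, ← pow_add, ← two_mul, pow_mul]
  norm_num

/-- `Sᶻ_x Sᶻ_y` is diagonal in the product basis, with entries `(n/2 - σ_x)(n/2 - σ_y)`.
[folklore] -/
private theorem spinZ_mul_spinZ_eq_diagonal (x y : Λ) :
    (onSite x (SpinOperators.spinZ n) * onSite y (SpinOperators.spinZ n) : Op Λ (n + 1)) =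
      diagonal fun σ => ((n : ℂ) / 2 - ((σ x : ℕ) : ℂ)) * ((n : ℂ) / 2 - ((σ y : ℕ) : ℂ)) := by
  rw [SpinOperators.spinZ, onSite_diagonal, onSite_diagonal, diagonal_mul_diagonal]

/-- One off-diagonal term of `⟨ψ, 𝐒_x·𝐒_y ψ⟩` for a Marshall-positive vector has NONNEGATIVE real
part when `x`, `y` lie on the same side of `A`: the matrix element is a nonnegative real, nonzero
only on a hop, and a hop inside a sublattice class preserves the Marshall sign. [folklore] -/
private theorem re_offDiag_term_nonneg {x y : Λ} (hxy : x ≠ y) (A : Finset Λ) (hA : x ∈ A ↔ y ∈ A)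
    {ψ : TensorIndex Λ (n + 1) → ℂ} {c : ℂ} (hc : c ≠ 0)
    (hpos : ∀ σ, 0 ≤ (c * marshallSign A σ * ψ σ).re ∧ (c * marshallSign A σ * ψ σ).im = 0)
    {σ τ : TensorIndex Λ (n + 1)} (hστ : σ ≠ τ) :
    0 ≤ (star (ψ σ) * (spinDot n x y σ τ * ψ τ)).re := by
  obtain ⟨t, ht, ht0⟩ := spinDot_apply_eq_real n hxy σ τ
  have ht0 : 0 ≤ t := ht0 hστ
  by_cases hz : spinDot n x y σ τ = 0
  · rw [hz, zero_mul, mul_zero, Complex.zero_re]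
  have hm : marshallSign A σ * marshallSign A τ = 1 := by
    rcases hop_of_spinDot_apply_ne_zero n hxy hστ hz with ⟨hx, hy, hrest⟩ | ⟨hy, hx, hrest⟩
    · exact marshallSign_mul_marshallSign_of_hop_same A hA hx hy hrest
    · exact marshallSign_mul_marshallSign_of_hop_same A hA.symm hy hx hrest
  obtain ⟨hσre, hσim⟩ := hpos σ
  obtain ⟨hτre, hτim⟩ := hpos τ
  obtain ⟨a, ha, ha0⟩ : ∃ a : ℝ, c * marshallSign A σ * ψ σ = a ∧ 0 ≤ a :=
    ⟨_, Complex.ext (by rw [Complex.ofReal_re]) (by rw [Complex.ofReal_im, hσim]), hσre⟩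
  obtain ⟨b, hb, hb0⟩ : ∃ b : ℝ, c * marshallSign A τ * ψ τ = b ∧ 0 ≤ b :=
    ⟨_, Complex.ext (by rw [Complex.ofReal_re]) (by rw [Complex.ofReal_im, hτim]), hτre⟩
  -- `conj(ψ σ) · t · ψ τ · |c|² = a t b`
  have hid : star (ψ σ) * ((t : ℂ) * ψ τ) * (star c * c) =
      star (c * marshallSign A σ * ψ σ) * (t : ℂ) * (c * marshallSign A τ * ψ τ) := by
    rw [star_mul', star_mul', star_marshallSign]
    linear_combination (-(star (ψ σ) * (t : ℂ) * ψ τ * star c * c)) * hm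
  have hstar_a : star (a : ℂ) = a := by rw [← starRingEnd_apply, Complex.conj_ofReal]
  have hcc : star c * c = ((Complex.normSq c : ℝ) : ℂ) := by
    rw [Complex.normSq_eq_conj_mul_self]; rfl
  rw [ha, hb, hstar_a, hcc,
    show ((a : ℂ) * (t : ℂ) * (b : ℂ)) = ((a * t * b : ℝ) : ℂ) by push_cast; ring] at hid
  have hre := congrArg Complex.re hid
  rw [Complex.re_mul_ofReal, Complex.ofReal_re] at hre
  rw [ht]
  have hN : 0 < Complex.normSq c := Complex.normSq_pos.2 hc
  have hatb : 0 ≤ a * t * b := by positivity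
  by_contra hX
  rw [not_le] at hX
  have := mul_neg_of_neg_of_pos hX hN
  linarith

/-- **Marshall's sign rule for same-sublattice correlations (vector form).** If `x ≠ y` lie on the
same side of the sublattice `A` and every amplitude `c (-1)^{Σ_{z∈A} σ_z} ψ(σ)` (`c ≠ 0` fixed) is
a nonnegative real, then `Re⟨ψ, Sᶻ_x Sᶻ_y ψ⟩ ≤ Re⟨ψ, 𝐒_x·𝐒_y ψ⟩`: the spin-flip part
`½(S⁺_xS⁻_y + S⁻_xS⁺_y)` has nonnegative matrix elements joining configurations of equal Marshall
sign. Marshall (1955); Lieb–Mattis (1962), proof of Thm 2; Auerbach (1994) Thm 5.1, eq. (5.12).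
[cite: LiebMattis1962, Theorem 2] [cite: Marshall1955, sign rule] -/
theorem re_dotProduct_spinZ_mulVec_le_spinDot_of_marshall {x y : Λ} (hxy : x ≠ y) (A : Finset Λ)
    (hA : x ∈ A ↔ y ∈ A) {ψ : TensorIndex Λ (n + 1) → ℂ} {c : ℂ} (hc : c ≠ 0)
    (hpos : ∀ σ, 0 ≤ (c * marshallSign A σ * ψ σ).re ∧ (c * marshallSign A σ * ψ σ).im = 0) :
    (star ψ ⬝ᵥ
        ((onSite x (SpinOperators.spinZ n) * onSite y (SpinOperators.spinZ n)) *ᵥ ψ)).re ≤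
      (star ψ ⬝ᵥ (spinDot n x y *ᵥ ψ)).re := by
  have hL : star ψ ⬝ᵥ (spinDot n x y *ᵥ ψ) =
      ∑ σ, star (ψ σ) * ∑ τ, spinDot n x y σ τ * ψ τ := by
    simp only [dotProduct, mulVec, Pi.star_apply]
  have hR : star ψ ⬝ᵥ ((onSite x (SpinOperators.spinZ n) * onSite y (SpinOperators.spinZ n)) *ᵥ ψ) =
      ∑ σ, star (ψ σ) *
        ((((n : ℂ) / 2 - ((σ x : ℕ) : ℂ)) * ((n : ℂ) / 2 - ((σ y : ℕ) : ℂ))) * ψ σ) := by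
    rw [spinZ_mul_spinZ_eq_diagonal]
    simp only [dotProduct, mulVec_diagonal, Pi.star_apply]
  rw [hL, hR, Complex.re_sum, Complex.re_sum]
  refine Finset.sum_le_sum fun σ _ => ?_
  rw [Finset.mul_sum, Complex.re_sum, ← Finset.add_sum_erase _ _ (Finset.mem_univ σ),
    spinDot_apply_self n hxy σ]
  have hoff : 0 ≤ ∑ τ ∈ Finset.univ.erase σ, (star (ψ σ) * (spinDot n x y σ τ * ψ τ)).re :=
    Finset.sum_nonneg fun τ hτ =>
      re_offDiag_term_nonneg n hxy A hA hc hpos (Finset.ne_of_mem_erase hτ).symm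
  linarith

/-! ### The ground state of the balanced bipartite antiferromagnet -/

variable (G : SimpleGraph Λ) [DecidableRel G.Adj] (A : Finset Λ) (J : ℝ)

/-- **Marshall's sign rule for same-sublattice ground-state correlations.** For the Heisenberg
antiferromagnet (`J > 0`) on a connected graph bipartite in `A`, `Aᶜ` with `|A| = |Aᶜ|`, and
`x ≠ y` on the SAME sublattice, `Re ω₀(Sᶻ_x Sᶻ_y) ≤ Re ω₀(𝐒_x·𝐒_y)` in the (unique, tracial =
vector) ground state. Marshall (1955); Lieb–Mattis (1962) Thm 2 (sign rule and uniqueness);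
Auerbach (1994) Thm 5.1. [cite: LiebMattis1962, Theorem 2] [cite: Marshall1955, sign rule] -/
theorem re_groundStateFunctional_spinZ_le_spinDot (hG : G.Connected)
    (hA : G.IsBipartiteWith (A : Set Λ) (↑A)ᶜ) (hJ : 0 < J) (hcard : Aᶜ.card = A.card)
    {x y : Λ} (hxy : x ≠ y) (hxA : x ∈ A ↔ y ∈ A) :
    ((heisenbergHamiltonian n G J).groundStateFunctional
        (onSite x (SpinOperators.spinZ n) * onSite y (SpinOperators.spinZ n))).re ≤
      ((heisenbergHamiltonian n G J).groundStateFunctional (spinDot n x y)).re := by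
  have hHerm := heisenbergHamiltonian_isHermitian n G J
  obtain ⟨ψ, hψ, hψ0⟩ :=
    Submodule.exists_mem_ne_zero_of_ne_bot (Matrix.groundSpace_ne_bot_holds hHerm)
  have hU := hasUniqueGroundState_of_card_compl_eq n G A J hG hA hJ hcard
  obtain ⟨hK, c, hc, hpos⟩ := groundState_mem_sector_and_marshall n G A J hG hA hJ hcard hψ hψ0
  have hsupp := (mem_spinZSector_weight_iff (n := n) (Aᶜ.card * n) ψ).1 hK
  have hpos' : ∀ σ, 0 ≤ (c * marshallSign A σ * ψ σ).re ∧ (c * marshallSign A σ * ψ σ).im = 0 := by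
    intro σ
    by_cases hw : (∑ z, (σ z : ℕ)) = Aᶜ.card * n
    · exact ⟨(hpos σ hw).1.le, (hpos σ hw).2⟩
    · rw [hsupp σ hw, mul_zero]
      simp
  have hvec := re_dotProduct_spinZ_mulVec_le_spinDot_of_marshall n hxy A hxA hc hpos'
  have hnorm : 0 < star ψ ⬝ᵥ ψ := Matrix.dotProduct_star_self_pos_iff.2 hψ0
  obtain ⟨hre, him⟩ := Complex.pos_iff.1 hnorm
  have hr : star ψ ⬝ᵥ ψ = (((star ψ ⬝ᵥ ψ).re : ℝ) : ℂ) :=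
    Complex.ext (by rw [Complex.ofReal_re]) (by rw [Complex.ofReal_im, ← him])
  rw [groundStateFunctional_eq_of_hasUniqueGroundState hU hψ hψ0,
    groundStateFunctional_eq_of_hasUniqueGroundState hU hψ hψ0, hr, Complex.div_ofReal_re,
    Complex.div_ofReal_re]
  exact div_le_div_of_nonneg_right hvec hre.le

end LiebMattis

/-! ### The even torus: same-parity correlations are nonnegative -/

section Torus

open Literature.Probability.LatticeModels

variable {d : ℕ}

/-- **Marshall's sign rule on the even torus, same sublattice**: in the ground state of the
spin-`n/2` Heisenberg antiferromagnet (`J > 0`) on `(ℤ/Lℤ)^d`, `L` even, `d ≥ 1`, the correlation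
`⟨𝐒_x·𝐒_y⟩₀` is nonnegative whenever `x ≠ y` have the same parity (sign rule
`Re ω₀(Sᶻ_xSᶻ_y) ≤ Re ω₀(𝐒_x·𝐒_y)` combined with isotropy `⟨𝐒_x·𝐒_y⟩₀ = 3⟨Sᶻ_xSᶻ_y⟩₀`).
Marshall (1955); Lieb–Mattis (1962) Thm 2; Kennedy–Lieb–Shastry (1988) p. 1021 (isotropy).
[cite: LiebMattis1962, Theorem 2] [cite: KLS1988JSP, p. 1021] -/
theorem groundStateSpinCorrTorus_nonneg_of_parity_eq (L : ℕ) [NeZero L] (hL : 2 ∣ L) (i : Fin d)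
    (n : ℕ) {J : ℝ} (hJ : 0 < J) {x y : TorusSite d L} (hne : x ≠ y)
    (hxy : torusSiteParity hL x = torusSiteParity hL y) :
    0 ≤ groundStateSpinCorrTorus L n J x y := by
  have hxA : x ∈ evenSublattice (d := d) L hL ↔ y ∈ evenSublattice (d := d) L hL := by
    rw [mem_evenSublattice_iff, mem_evenSublattice_iff, hxy]
  have hG := torusGraph_connected_of_proj d L
  have hbip := torusGraph_isBipartiteWith_evenSublattice (d := d) L hL
  have hcard := card_compl_evenSublattice (d := d) L hL i
  rw [groundStateSpinCorrTorus_eq_sum L n hJ, ← groundStateSpinCorrTorus_eq_sum L n one_pos]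
  have h1 : groundStateSpinCorrTorus L n 1 x y =
      ((heisenbergTorus d L n 1).groundStateFunctional (spinDot n x y)).re := by
    rw [groundStateSpinCorrTorus_of_neZero, ← map_sum, ← spinDot_eq_sum_mul_of_ne n hne]
  have h2 : groundStateSpinCorrTorus L n 1 x y =
      3 * ((heisenbergTorus d L n 1).groundStateFunctional
        (onSite x (SpinOperators.spinZ n) * onSite y (SpinOperators.spinZ n))).re := by
    rw [groundStateSpinCorrTorus_one_eq_three_mul, ← heisGroundCorr_eq_zero_comp 2,
      heisGroundCorr_of_neZero]
    rfl
  have h3 : ((heisenbergTorus d L n 1).groundStateFunctional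
        (onSite x (SpinOperators.spinZ n) * onSite y (SpinOperators.spinZ n))).re ≤
      ((heisenbergTorus d L n 1).groundStateFunctional (spinDot n x y)).re :=
    LiebMattis.re_groundStateFunctional_spinZ_le_spinDot n (torusGraph d L) _ 1 hG hbip one_pos
      hcard hne hxA
  linarith

/-- The parity of the site `(a, b)` of the square torus (`L` even) is `a + b (mod 2)`. [folklore] -/
private theorem torusSiteParity_vecTwo {L : ℕ} [NeZero L] (hL : 2 ∣ L) (a b : ℕ) :
    torusSiteParity hL (![(a : ZMod L), (b : ZMod L)] : TorusSite 2 L) = ((a + b : ℕ) : ZMod 2) := by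
  simp [torusSiteParity, Fin.sum_univ_two, ZMod.cast_natCast hL]

/-- The parity of the origin of the torus is `0`. [folklore] -/
private theorem torusSiteParity_zero {L : ℕ} [NeZero L] (hL : 2 ∣ L) :
    torusSiteParity hL (0 : TorusSite d L) = 0 := by
  simp [torusSiteParity]

/-- **Marshall's sign rule for the reduced two-point function, even sublattice**: on the square
torus `(ℤ/Lℤ)²`, `L` even, `c(a,b) = ⟨Sᶻ_0 Sᶻ_(a,b)⟩₀ ≥ 0` whenever `a + b` is even
(`c(0,0) = S(S+1)/3 > 0` on the diagonal). Marshall (1955); Lieb–Mattis (1962) Thm 2;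
Kennedy–Lieb–Shastry (1988) p. 1021. [cite: LiebMattis1962, Theorem 2] [cite: KLS1988JSP, p. 1021] -/
theorem heisRedCorr2_nonneg_of_even (L : ℕ) [NeZero L] (hL : 2 ∣ L) (n a b : ℕ)
    (hab : 2 ∣ a + b) : 0 ≤ heisRedCorr2 L n a b := by
  by_cases h0 : (0 : TorusSite 2 L) = ![(a : ZMod L), (b : ZMod L)]
  · rw [heisRedCorr2, ← h0, heisGroundCorr_self]
    positivity
  have hpar : torusSiteParity hL (0 : TorusSite 2 L) =
      torusSiteParity hL (![(a : ZMod L), (b : ZMod L)] : TorusSite 2 L) := by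
    rw [torusSiteParity_zero, torusSiteParity_vecTwo, (ZMod.natCast_eq_zero_iff _ _).2 hab]
  have h3 : 3 * heisRedCorr2 L n a b =
      groundStateSpinCorrTorus L n 1 0 ![(a : ZMod L), (b : ZMod L)] := by
    rw [groundStateSpinCorrTorus_one_eq_three_mul, heisRedCorr2]
  have hq := groundStateSpinCorrTorus_nonneg_of_parity_eq L hL (0 : Fin 2) n one_pos h0 hpar
  linarith

/-- **Marshall's sign rule for the reduced two-point function, odd sublattice**: on the square
torus `(ℤ/Lℤ)²`, `L` even, `c(a,b) = ⟨Sᶻ_0 Sᶻ_(a,b)⟩₀ ≤ 0` whenever `a + b` is odd.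
Marshall (1955); Lieb–Mattis (1962) Thm 2; Kennedy–Lieb–Shastry (1988) p. 1021.
[cite: LiebMattis1962, Theorem 2] [cite: KLS1988JSP, p. 1021] -/
theorem heisRedCorr2_nonpos_of_odd (L : ℕ) [NeZero L] (hL : 2 ∣ L) (n a b : ℕ)
    (hab : ¬ 2 ∣ a + b) : heisRedCorr2 L n a b ≤ 0 := by
  have hpar : torusSiteParity hL (0 : TorusSite 2 L) ≠
      torusSiteParity hL (![(a : ZMod L), (b : ZMod L)] : TorusSite 2 L) := by
    rw [torusSiteParity_zero, torusSiteParity_vecTwo]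
    intro h
    exact hab ((ZMod.natCast_eq_zero_iff _ _).1 h.symm)
  have h3 : 3 * heisRedCorr2 L n a b =
      groundStateSpinCorrTorus L n 1 0 ![(a : ZMod L), (b : ZMod L)] := by
    rw [groundStateSpinCorrTorus_one_eq_three_mul, heisRedCorr2]
  have hq := groundStateSpinCorrTorus_nonpos_of_parity_ne L hL (0 : Fin 2) n one_pos hpar
  linarith

end Torus

end Literature.MathematicalPhysics.QuantumLattice
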